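/-
Copyright: the b2b-balaban T⁴-continuum CRUX team, row NE7b OWNER lineage `t4-ne7b-p1` (gen 145). Project licence.
-/
import Summits.QuantumFields.BalabanUV.T4Continuum.Spine.NE7b.SupWeightedTwoPointMasters

/-!
# WEIGHTED TWO-POINT MASTERS, TWO FAMILIES (SCOPING-d17 (R-c) toolbox, second file).  (653) bounds `Σ_r E_D(b_r,a)·ϑ_r` for ONE anchor
# profile `a` and one family `b_r`.  In the slot sums of `M₃, M₄′, M₅′` BOTH factors of a two-point term usually vary with summed display
# indices: `Σ_{r,s} E_D(g_r, b_s)·α_r·β_s` with an anchor-side family `g_r` (the `K3`-, `K4`-, `K5`-vectors carrying the anchor and some display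
# indices, weight `α_r` kept on the anchor side) and a leg family `b_s` (weight `β_s ≤ σ_w·σ′_{sw}` routed through the sampler index).  THIS
# FILE: with `D`'s weighted letters `dθ, dθ′`, the anchor family's WEIGHTED MASS `Σ_r α_r Σ_{z′} g_{rz′}σ₁_{z′} ≤ αm` and the leg family's weighted
# column letter `Σ_s b_{sz′}σ′₁_{sz′} ≤ αfc`,
#   `Σ_r Σ_s E_D(g_r,b_s)·(α_r·β_s) ≤ dθ·αm·(dθ′·αfc)∕(1−lamA)`   (both orientations)
# — (527)'s plain «mass × column» masters with weights; (653) is the case of a one-point anchor family (row NE7b, node U5c; (653)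
# `transported_family_le` BY NAME; Mathlib only otherwise; [folklore]).

Cell `pub-balaban`, sub-cell `t4`, spine estimate NE7b (`T4WeightBudget.RelWeightBound`; the cell's OWN estimate — NOT PRINTED in
[Bałaban 1983–89], NOT PROVED).  Crux-route work under `Spine/NE7b/` by the row OWNER (`t4-ne7b-p1` gen 145, file (656)) under FREEZE
(0)'s crux-prover clause; NOTHING of Bałaban's is named as a Lean object, valued or asserted; no `T4Continuum/Support` leaf typed; no
`def`, no notation; zero `sorry`.  Imports (BY NAME): the OWNER's (653) `…SupWeightedTwoPointMasters` (`transported_family_le`).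

WHAT IS PROVED ([folklore]): `transported_mass_le` (`Σ_r α_r Σ_w (Dᵀg_r)_wσ_w ≤ dθ·αm`), THE ENDS **`weighted_two_point_two_families_le`**,
**`weighted_two_point_two_families_le'`**; toy.

HONEST (what this is NOT).  Abstract bookkeeping; the instances are the weighted slot files; scalar skeleton ((A3), NC-NE7b-α UNRULED);
nothing of Bałaban's asserted.  BY-NAME EFFECT ON THE WALL: NONE.  NE7b NOT PRINTED ∕ NOT PROVED; spine PROVED 0∕9; rung (B)+1 — the
programme's measures remain FINITE-torus statements; NOT the mass gap, NOT Clay.  HONEST DEPENDENCY: continuum YM on T⁴ ⇐ BetaPertH ∧ nine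
spine estimates (0∕9 proved); BetaPertH ⇐ (D1) ∧ (D4) ∧ CAP+tail; G-an2-4 gates asym, D1 and NE2∕3∕4.
-/

set_option autoImplicit false

noncomputable section

namespace Summit.QuantumFields.BalabanUV.T4Continuum.NE7b.SupWeightedTwoPointMastersTwo

open Finset Real
open scoped BigOperators
open SupWeightedTwoPointMasters (transported_family_le)

variable {κ R S : Type} [Fintype κ] [Fintype R] [Fintype S]

variable {D : κ → κ → ℝ} {θ : κ → κ → ℝ} {σ σ₁ : κ → ℝ} {g : R → κ → ℝ} {α : R → ℝ} {b σ' σ'₁ : S → κ → ℝ} {β : S → ℝ}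
  {lamA dθ dθ' αm αfc : ℝ}

omit [Fintype S] in
/-- **The anchor family's transported weighted mass**: `Σ_r α_r·Σ_w (Dᵀg_r)_w·σ_w ≤ dθ·αm`. [folklore] -/
theorem transported_mass_le (hg0 : ∀ r z', 0 ≤ g r z') (hα0 : ∀ r, 0 ≤ α r) (hD : ∀ x y, 0 ≤ D x y) (hσ₁0 : ∀ z', 0 ≤ σ₁ z')
    (hσθ : ∀ z' w, σ w ≤ σ₁ z' * θ z' w) (hDr : ∀ z', ∑ w, D z' w * θ z' w ≤ dθ) (hdθ : 0 ≤ dθ)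
    (hαm : ∑ r, α r * ∑ z', g r z' * σ₁ z' ≤ αm) :
    ∑ r, α r * ∑ w, (∑ z', D z' w * g r z') * σ w ≤ dθ * αm := by
  have hr : ∀ r, ∑ w, (∑ z', D z' w * g r z') * σ w ≤ dθ * ∑ z', g r z' * σ₁ z' := fun r => by
    calc ∑ w, (∑ z', D z' w * g r z') * σ w ≤ ∑ w, ∑ z', D z' w * θ z' w * (g r z' * σ₁ z') := by
          refine sum_le_sum fun w _ => ?_
          rw [sum_mul]
          refine sum_le_sum fun z' _ => ?_
          calc D z' w * g r z' * σ w ≤ D z' w * g r z' * (σ₁ z' * θ z' w) := mul_le_mul_of_nonneg_left (hσθ z' w) (mul_nonneg (hD z' w) (hg0 r z'))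
            _ = D z' w * θ z' w * (g r z' * σ₁ z') := by ring
      _ = ∑ z', (∑ w, D z' w * θ z' w) * (g r z' * σ₁ z') := by
          rw [sum_comm]; exact sum_congr rfl fun z' _ => (Finset.sum_mul _ _ _).symm
      _ ≤ ∑ z', dθ * (g r z' * σ₁ z') := sum_le_sum fun z' _ => mul_le_mul_of_nonneg_right (hDr z') (mul_nonneg (hg0 r z') (hσ₁0 z'))
      _ = dθ * ∑ z', g r z' * σ₁ z' := by rw [mul_sum]
  calc ∑ r, α r * ∑ w, (∑ z', D z' w * g r z') * σ w ≤ ∑ r, α r * (dθ * ∑ z', g r z' * σ₁ z') :=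
        sum_le_sum fun r _ => mul_le_mul_of_nonneg_left (hr r) (hα0 r)
    _ = dθ * ∑ r, α r * ∑ z', g r z' * σ₁ z' := by rw [mul_sum]; exact sum_congr rfl fun r _ => by ring
    _ ≤ dθ * αm := mul_le_mul_of_nonneg_left hαm hdθ

/-- **THE WEIGHTED TWO-POINT MASTER, TWO FAMILIES** (leg factor first): `Σ_rΣ_s E_D(b_s,g_r)·(α_r·β_s) ≤ dθ·αm·(dθ′·αfc)∕(1−lamA)`, the leg
weight routed `β_s ≤ σ_w·σ′_{sw}` through the sampler index. [folklore] -/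
theorem weighted_two_point_two_families_le (hg0 : ∀ r z', 0 ≤ g r z') (hα0 : ∀ r, 0 ≤ α r) (hb0 : ∀ s z', 0 ≤ b s z')
    (hD : ∀ x y, 0 ≤ D x y) (hθnn : ∀ z w, 0 ≤ θ z w) (hσ0 : ∀ w, 0 ≤ σ w) (hσ₁0 : ∀ z', 0 ≤ σ₁ z') (hβ : ∀ s w, β s ≤ σ w * σ' s w)
    (hσθ : ∀ z' w, σ w ≤ σ₁ z' * θ z' w) (hσθ' : ∀ s z' w, σ' s w ≤ σ'₁ s z' * θ z' w) (hDr : ∀ z', ∑ w, D z' w * θ z' w ≤ dθ) (hdθ : 0 ≤ dθ)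
    (hDc : ∀ w, ∑ z', D z' w * θ z' w ≤ dθ') (hdθ' : 0 ≤ dθ') (hαm : ∑ r, α r * ∑ z', g r z' * σ₁ z' ≤ αm)
    (hfc : ∀ z', ∑ s, b s z' * σ'₁ s z' ≤ αfc) (hαfc : 0 ≤ αfc) (hlamA1 : lamA < 1) :
    ∑ r, ∑ s, (∑ w, (∑ z', D z' w * b s z') * (∑ z', D z' w * g r z') / (1 - lamA)) * (α r * β s) ≤ dθ * αm * (dθ' * αfc) / (1 - lamA) := by
  have hl : 0 < 1 - lamA := by linarith
  have hP0 : ∀ (s : S) (w : κ), 0 ≤ ∑ z', D z' w * b s z' := fun s w => sum_nonneg fun z' _ => mul_nonneg (hD z' w) (hb0 s z')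
  have hQ0 : ∀ (r : R) (w : κ), 0 ≤ ∑ z', D z' w * g r z' := fun r w => sum_nonneg fun z' _ => mul_nonneg (hD z' w) (hg0 r z')
  -- inner sum over `s` for each `r`: (653)'s routing with the anchor factor `(Dᵀg_r)_w σ_w`
  have hinner : ∀ r, ∑ s, (∑ w, (∑ z', D z' w * b s z') * (∑ z', D z' w * g r z') / (1 - lamA)) * β s ≤
      (∑ w, (∑ z', D z' w * g r z') * σ w) * (dθ' * αfc / (1 - lamA)) := fun r => by
    have h1 : ∑ s, (∑ w, (∑ z', D z' w * b s z') * (∑ z', D z' w * g r z') / (1 - lamA)) * β s ≤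
        ∑ s, ∑ w, ((∑ z', D z' w * g r z') * σ w) * (((∑ z', D z' w * b s z') * σ' s w) / (1 - lamA)) := by
      refine sum_le_sum fun s _ => ?_
      rw [sum_mul]
      refine sum_le_sum fun w _ => ?_
      rw [div_mul_eq_mul_div, ← mul_div_assoc]
      refine div_le_div_of_nonneg_right ?_ hl.le
      calc (∑ z', D z' w * b s z') * (∑ z', D z' w * g r z') * β s ≤ (∑ z', D z' w * b s z') * (∑ z', D z' w * g r z') * (σ w * σ' s w) :=
            mul_le_mul_of_nonneg_left (hβ s w) (mul_nonneg (hP0 s w) (hQ0 r w))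
        _ = (∑ z', D z' w * g r z') * σ w * ((∑ z', D z' w * b s z') * σ' s w) := by ring
    refine h1.trans ?_
    rw [sum_comm]
    calc ∑ w, ∑ s, (∑ z', D z' w * g r z') * σ w * ((∑ z', D z' w * b s z') * σ' s w / (1 - lamA))
        = ∑ w, (∑ z', D z' w * g r z') * σ w * ((∑ s, (∑ z', D z' w * b s z') * σ' s w) / (1 - lamA)) :=
          sum_congr rfl fun w _ => by rw [← mul_sum, ← sum_div]
      _ ≤ ∑ w, (∑ z', D z' w * g r z') * σ w * (dθ' * αfc / (1 - lamA)) :=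
          sum_le_sum fun w _ => mul_le_mul_of_nonneg_left
            (div_le_div_of_nonneg_right (transported_family_le hb0 hD hθnn hσθ' hDc hfc hαfc w) hl.le) (mul_nonneg (hQ0 r w) (hσ0 w))
      _ = (∑ w, (∑ z', D z' w * g r z') * σ w) * (dθ' * αfc / (1 - lamA)) := by rw [sum_mul]
  have hK : 0 ≤ dθ' * αfc / (1 - lamA) := div_nonneg (mul_nonneg hdθ' hαfc) hl.le
  calc ∑ r, ∑ s, (∑ w, (∑ z', D z' w * b s z') * (∑ z', D z' w * g r z') / (1 - lamA)) * (α r * β s)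
      = ∑ r, α r * ∑ s, (∑ w, (∑ z', D z' w * b s z') * (∑ z', D z' w * g r z') / (1 - lamA)) * β s :=
        sum_congr rfl fun r _ => by rw [mul_sum]; exact sum_congr rfl fun s _ => by ring
    _ ≤ ∑ r, α r * ((∑ w, (∑ z', D z' w * g r z') * σ w) * (dθ' * αfc / (1 - lamA))) :=
        sum_le_sum fun r _ => mul_le_mul_of_nonneg_left (hinner r) (hα0 r)
    _ = (∑ r, α r * ∑ w, (∑ z', D z' w * g r z') * σ w) * (dθ' * αfc / (1 - lamA)) := by
        rw [sum_mul]; exact sum_congr rfl fun r _ => by ring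
    _ ≤ dθ * αm * (dθ' * αfc / (1 - lamA)) := mul_le_mul_of_nonneg_right (transported_mass_le hg0 hα0 hD hσ₁0 hσθ hDr hdθ hαm) hK
    _ = dθ * αm * (dθ' * αfc) / (1 - lamA) := by ring

/-- **THE WEIGHTED TWO-POINT MASTER, TWO FAMILIES** (anchor factor first inside the product). [folklore] -/
theorem weighted_two_point_two_families_le' (hg0 : ∀ r z', 0 ≤ g r z') (hα0 : ∀ r, 0 ≤ α r) (hb0 : ∀ s z', 0 ≤ b s z')
    (hD : ∀ x y, 0 ≤ D x y) (hθnn : ∀ z w, 0 ≤ θ z w) (hσ0 : ∀ w, 0 ≤ σ w) (hσ₁0 : ∀ z', 0 ≤ σ₁ z') (hβ : ∀ s w, β s ≤ σ w * σ' s w)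
    (hσθ : ∀ z' w, σ w ≤ σ₁ z' * θ z' w) (hσθ' : ∀ s z' w, σ' s w ≤ σ'₁ s z' * θ z' w) (hDr : ∀ z', ∑ w, D z' w * θ z' w ≤ dθ) (hdθ : 0 ≤ dθ)
    (hDc : ∀ w, ∑ z', D z' w * θ z' w ≤ dθ') (hdθ' : 0 ≤ dθ') (hαm : ∑ r, α r * ∑ z', g r z' * σ₁ z' ≤ αm)
    (hfc : ∀ z', ∑ s, b s z' * σ'₁ s z' ≤ αfc) (hαfc : 0 ≤ αfc) (hlamA1 : lamA < 1) :
    ∑ r, ∑ s, (∑ w, (∑ z', D z' w * g r z') * (∑ z', D z' w * b s z') / (1 - lamA)) * (α r * β s) ≤ dθ * αm * (dθ' * αfc) / (1 - lamA) := by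
  have e : ∀ r s, ∑ w, (∑ z', D z' w * g r z') * (∑ z', D z' w * b s z') / (1 - lamA) =
      ∑ w, (∑ z', D z' w * b s z') * (∑ z', D z' w * g r z') / (1 - lamA) := fun r s => sum_congr rfl fun w _ => by rw [mul_comm]
  simp_rw [e]
  exact weighted_two_point_two_families_le hg0 hα0 hb0 hD hθnn hσ0 hσ₁0 hβ hσθ hσθ' hDr hdθ hDc hdθ' hαm hfc hαfc hlamA1

/-! ## Toy -/

/-- Toy (the product weight splits): `α·β` with `β ≤ σσ′` is how a star weight is routed — one factor stays, one travels. -/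
example (α β σ σ' : ℝ) (hα : 0 ≤ α) (h : β ≤ σ * σ') : α * β ≤ α * (σ * σ') := mul_le_mul_of_nonneg_left h hα

end Summit.QuantumFields.BalabanUV.T4Continuum.NE7b.SupWeightedTwoPointMastersTwo

end
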